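import Literature.AlgebraicGeometry.HodgeTheory.CMHodgeGroupNoTwist
import HarnessLib

/-!
# No twist between the `𝔰𝔩(W_σ)`-blocks of `Lie Hg` for a CM field with one BALANCED place: the LIFT property for the
# sextic CM pattern `(n_σ) = (2,2,1)` (Moonen–Zarhin 1999 §2 (2.3); Ribet 1983 §3; Deligne LNM 900 I §3)

Family `hodge`, layer `Literature/AlgebraicGeometry/HodgeTheory` (brick P3(β) of the design note
`HOME/jobs/A7-inventory-eng5g6/DESIGN-rows10-12-allmembers.md` of the cell `pub-hodgeav-hg6`, req-37 (A) Q2b, TABLE X row 12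
ALL MEMBERS, pattern `(2,2,1)`; companion of `CMHodgeGroupNoTwist`, whose one-`Θ`-scalar-place theorem it mirrors).
UNCONDITIONAL; theorems only, no definition, no named fact, no `sorry`. HONEST FRAMING of that cell: HC / HC_AV / HC_CM / H2
NOT proved — linear algebra of polarized weight-one Hodge structures.

SETTING as in `CMNoTwist.lift_of_unique_unbalanced`, but now `k₀` is the unique BALANCED place and the other places are
`Θ`-scalar. LIFT at `k₀` and the mixed twists go exactly as there. A twist between the two `Θ`-scalar places `k, j` is
killed as follows (Galois-free): the `b`-trick (`b ∈ {φ + φ†, φφ†}`, `σ_k(b) ≠ σ_j(b)`) produces the rational space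
`N′ = {X ∈ 𝔡 : bX ∈ 𝔡}` of dimension `≥ 3` whose elements kill `W_k` and `W_j`; so `(N′)_ℂ` IS the block `𝔫_{k₀} ≅ 𝔰𝔩(W_{k₀})`
of lifts at `k₀` (dimension count, §1). The rational orthogonal `R = {Y ∈ 𝔡 : Tr_V(Y X) = 0 ∀ X ∈ N′}` has dimension
`≥ 6 − 3 > 0`; for `Y ∈ R` and every traceless `Z′` of `W_{k₀}`, `0 = Tr_V(Y_ℂ · lift Z′) = 2 tr(Y|_{W_{k₀}} Z′)` (duality of
the conjugate blocks, §1), so `Y|_{W_{k₀}}` is a traceless scalar, i.e. `0`, and `Y = 0` by `CMDerived.eq_zero_of_forall_balanced`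
(the other places are `Θ`-scalar) — a contradiction.
* §1 `CMNoTwist.trace_mul_eq_sum_blocks` (for `B`-skew `S, D`: `Tr(SD) = Σ_k (tr_k(SD) + tr_k(DS))` in an adapted dual
  basis), `CMNoTwist.exists_smul_one_of_forall_trace_mul_eq_zero` (`tr(YZ′) = 0` for all traceless `Z′` on a plane forces
  `Y` scalar), `CMNoTwist.finrank_le_three_of_vanish`, `CMNoTwist.exists_ne_zero_trace_orthogonal` (dimension count).
* §2 **`CMNoTwist.lift_of_unique_balanced`** — THE LIFT PROPERTY for `n₀ = 2`, `|ι| ≤ 3`, one balanced place.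

## References
* [MoonenZarhin1999LowDim] B. Moonen, Yu. Zarhin, Math. Ann. 315 (1999), §2 (2.3).
* [Ribet1983] K. A. Ribet, Amer. J. Math. 105 (1983), §3, Thm. 0.
* [Deligne1982HodgeCycles] P. Deligne, LNM 900 (1982), I §3 (proof of Prop. 3.4), §4 (p. 30).
* [Lang2002] S. Lang, Algebra, GTM 211, Ch. XIII §3, §5.
-/

noncomputable section

open scoped TensorProduct
open Module

namespace Literature.AlgebraicGeometry.Motives

namespace HodgeStructure

universe u

variable {V : Type u} [AddCommGroup V] [Module ℚ V] {n : ℤ}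

/-! ### §1 Preliminaries -/

section Dual

variable {K M : Type*} [Field K] [AddCommGroup M] [Module K M] {ι : Type*} [Fintype ι] [DecidableEq ι] {n₀ : ℕ}

/-- **`Tr(SD) = Σ_k (tr_k(SD) + tr_k(DS))`** for two `B`-skew operators in an adapted dual basis (the `(k,1)`-diagonal
entries of `SD` are the `(k,0)`-diagonal entries of `DS`, by duality). [cite: Lang2002, Ch. XIII §5] -/
theorem CMNoTwist.trace_mul_eq_sum_blocks (cb : Module.Basis ((ι × Fin 2) × Fin n₀) K M) (B : M →ₗ[K] M →ₗ[K] K)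
    (hdual : ∀ k k' i j, B (cb ((k, 0), i)) (cb ((k', 1), j)) = if k = k' ∧ i = j then 1 else 0)
    (hiso : ∀ k k' (t : Fin 2) i j, B (cb ((k, t), i)) (cb ((k', t), j)) = 0) (S D : Module.End K M)
    (hSskew : ∀ x y, B (S x) y + B x (S y) = 0) (hDskew : ∀ x y, B (D x) y + B x (D y) = 0) :
    LinearMap.trace K M (S * D) = ∑ k, (∑ j, cb.repr ((S * D) (cb ((k, 0), j))) ((k, 0), j) +
      ∑ j, cb.repr ((D * S) (cb ((k, 0), j))) ((k, 0), j)) := by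
  rw [CMArith.trace_eq_sum_repr cb, Fintype.sum_prod_type, Fintype.sum_prod_type]
  refine Finset.sum_congr rfl fun k _ => ?_
  rw [Fin.sum_univ_two]
  congr 1
  refine Finset.sum_congr rfl fun j _ => ?_
  rw [CMArith.repr_one_eq cb B hdual hiso, CMArith.repr_zero_eq cb B hdual hiso, Module.End.mul_apply,
    Module.End.mul_apply]
  have e1 := hSskew (cb ((k, 0), j)) (D (cb ((k, 1), j)))
  have e2 := hDskew (S (cb ((k, 0), j))) (cb ((k, 1), j))
  linear_combination e1 - e2

end Dual

section Plane

variable {K W : Type*} [Field K] [AddCommGroup W] [Module K W] [FiniteDimensional K W]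

/-- **On a plane, `tr(Y Z′) = 0` for every traceless `Z′` forces `Y` to be a scalar** (the trace pairing is perfect and
`𝔰𝔩^⊥ = K·1`; tested against an `𝔰𝔩₂`-triple). [cite: Lang2002, Ch. XIII §3] [cite: Humphreys1972, §2.1] -/
theorem CMNoTwist.exists_smul_one_of_forall_trace_mul_eq_zero (h2 : Module.finrank K W = 2) (Y : Module.End K W)
    (hY : ∀ Z : Module.End K W, LinearMap.trace K W Z = 0 → LinearMap.trace K W (Y * Z) = 0) :
    ∃ c : K, Y = c • 1 := by
  classical
  obtain ⟨bW⟩ : Nonempty (Module.Basis (Fin 2) K W) := ⟨Module.finBasisOfFinrankEq K W h2⟩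
  obtain ⟨e, he0, he1⟩ : ∃ e : Module.End K W, e (bW 0) = 0 ∧ e (bW 1) = bW 0 :=
    ⟨bW.constr K ![(0 : W), bW 0], by rw [Module.Basis.constr_basis]; rfl, by rw [Module.Basis.constr_basis]; rfl⟩
  obtain ⟨f, hf0, hf1⟩ : ∃ f : Module.End K W, f (bW 0) = bW 1 ∧ f (bW 1) = 0 :=
    ⟨bW.constr K ![bW 1, (0 : W)], by rw [Module.Basis.constr_basis]; rfl, by rw [Module.Basis.constr_basis]; rfl⟩
  obtain ⟨h, hh0, hh1⟩ : ∃ h : Module.End K W, h (bW 0) = bW 0 ∧ h (bW 1) = -bW 1 :=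
    ⟨bW.constr K ![bW 0, -bW 1], by rw [Module.Basis.constr_basis]; rfl, by rw [Module.Basis.constr_basis]; rfl⟩
  have hr00 : bW.repr (bW 0) 0 = 1 := by rw [bW.repr_self, Finsupp.single_eq_same]
  have hr11 : bW.repr (bW 1) 1 = 1 := by rw [bW.repr_self, Finsupp.single_eq_same]
  have hr01 : bW.repr (bW 0) 1 = 0 := by rw [bW.repr_self, Finsupp.single_apply, if_neg (by decide)]
  have hr10 : bW.repr (bW 1) 0 = 0 := by rw [bW.repr_self, Finsupp.single_apply, if_neg (by decide)]
  have htre : LinearMap.trace K W e = 0 := by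
    rw [CMArith.trace_eq_sum_repr bW, Fin.sum_univ_two, he0, he1, LinearEquiv.map_zero, Finsupp.coe_zero,
      Pi.zero_apply, hr01, add_zero]
  have htrf : LinearMap.trace K W f = 0 := by
    rw [CMArith.trace_eq_sum_repr bW, Fin.sum_univ_two, hf0, hf1, LinearEquiv.map_zero, Finsupp.coe_zero,
      Pi.zero_apply, hr10, add_zero]
  have htrh : LinearMap.trace K W h = 0 := by
    rw [CMArith.trace_eq_sum_repr bW, Fin.sum_univ_two, hh0, hh1, map_neg, Finsupp.neg_apply, hr00, hr11,
      add_neg_cancel]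
  have hYe := hY e htre
  have hYf := hY f htrf
  have hYh := hY h htrh
  rw [CMArith.trace_eq_sum_repr bW, Fin.sum_univ_two, Module.End.mul_apply, Module.End.mul_apply, he0, he1,
    show Y 0 = 0 from map_zero Y, show bW.repr 0 = 0 from map_zero _, Finsupp.coe_zero, Pi.zero_apply, zero_add] at hYe
  rw [CMArith.trace_eq_sum_repr bW, Fin.sum_univ_two, Module.End.mul_apply, Module.End.mul_apply, hf0, hf1,
    show Y 0 = 0 from map_zero Y, show bW.repr 0 = 0 from map_zero _, Finsupp.coe_zero, Pi.zero_apply, add_zero] at hYf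
  rw [CMArith.trace_eq_sum_repr bW, Fin.sum_univ_two, Module.End.mul_apply, Module.End.mul_apply, hh0, hh1, map_neg,
    map_neg, Finsupp.neg_apply] at hYh
  -- `Y b₀ = a b₀`, `Y b₁ = a b₁` with `a = [Y b₀]₀ = [Y b₁]₁`
  have ha : bW.repr (Y (bW 1)) 1 = bW.repr (Y (bW 0)) 0 := by linear_combination -hYh
  refine ⟨bW.repr (Y (bW 0)) 0, bW.ext fun i => ?_⟩
  fin_cases i
  · show Y (bW 0) = (bW.repr (Y (bW 0)) 0 • (1 : Module.End K W)) (bW 0)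
    rw [LinearMap.smul_apply, Module.End.one_apply]
    conv_lhs => rw [← bW.sum_repr (Y (bW 0))]
    rw [Fin.sum_univ_two, hYe, zero_smul, add_zero]
  · show Y (bW 1) = (bW.repr (Y (bW 0)) 0 • (1 : Module.End K W)) (bW 1)
    rw [LinearMap.smul_apply, Module.End.one_apply]
    conv_lhs => rw [← bW.sum_repr (Y (bW 1))]
    rw [Fin.sum_univ_two, hYf, zero_smul, zero_add, ha]

end Plane

/-- **A complex space of operators inducing `𝔰𝔩(W)` on a plane `W` and determined by that restriction has dimension `≤ 3`.**
[cite: Ribet1983, §3] -/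
theorem CMNoTwist.finrank_le_three_of_vanish {M : Type*} [AddCommGroup M] [Module ℂ M] [FiniteDimensional ℂ M]
    (D : Submodule ℂ (Module.End ℂ M)) (W : Submodule ℂ M) (h2 : Module.finrank ℂ ↥W = 2)
    (hDW : ∀ X ∈ D, ∀ w ∈ W, X w ∈ W) (htr : ∀ X (hX : X ∈ D), LinearMap.trace ℂ _ (X.restrict (hDW X hX)) = 0)
    (hinj : ∀ X ∈ D, (∀ w ∈ W, X w = 0) → X = 0) : Module.finrank ℂ ↥D ≤ 3 := by
  let ρ : ↥D →ₗ[ℂ] Module.End ℂ ↥W :=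
    { toFun := fun X => (X : Module.End ℂ M).restrict (hDW X X.2)
      map_add' := fun X Y => LinearMap.ext fun w => Subtype.ext (by
        simp only [Submodule.coe_add, LinearMap.add_apply, LinearMap.coe_restrict_apply])
      map_smul' := fun c X => LinearMap.ext fun w => Subtype.ext (by
        simp only [Submodule.coe_smul, LinearMap.smul_apply, LinearMap.coe_restrict_apply, RingHom.id_apply]) }
  have hρ : ∀ (X : ↥D) (w : ↥W), ((ρ X w : ↥W) : M) = (X : Module.End ℂ M) (w : M) := fun X w => rfl
  have hρinj : Function.Injective ρ := by
    refine (injective_iff_map_eq_zero ρ).2 fun X hX => Subtype.ext (hinj X X.2 fun w hw => ?_)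
    rw [← hρ X ⟨w, hw⟩, hX, LinearMap.zero_apply, Submodule.coe_zero]
  have hrange : LinearMap.range ρ ≤ LinearMap.ker (LinearMap.trace ℂ ↥W) := by
    rintro _ ⟨X, rfl⟩
    exact LinearMap.mem_ker.2 (htr X X.2)
  calc Module.finrank ℂ ↥D = Module.finrank ℂ ↥(LinearMap.range ρ) := (LinearMap.finrank_range_of_inj hρinj).symm
    _ ≤ Module.finrank ℂ ↥(LinearMap.ker (LinearMap.trace ℂ ↥W)) := Submodule.finrank_mono hrange
    _ = 3 := Literature.Algebra.Lie.finrank_ker_trace_eq_three (K := ℂ) h2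

/-- **Dimension count**: in a rational space `S` of operators of dimension `> r`, some non-zero element is trace-orthogonal
to an `r`-dimensional space `N` (given by a basis). [cite: Lang2002, Ch. XIII §5] -/
theorem CMNoTwist.exists_ne_zero_trace_orthogonal [Module.Finite ℚ V] (S N : Submodule ℚ (Module.End ℚ V)) {r : ℕ}
    (b : Module.Basis (Fin r) ℚ ↥N) (h : r < Module.finrank ℚ ↥S) :
    ∃ Y ∈ S, Y ≠ 0 ∧ ∀ X ∈ N, LinearMap.trace ℚ V (Y * X) = 0 := by
  haveI : Module.Free ℚ V := Module.Free.of_divisionRing ℚ V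
  let Λ : ↥S →ₗ[ℚ] (Fin r → ℚ) :=
    { toFun := fun Y i => LinearMap.trace ℚ V ((Y : Module.End ℚ V) * (b i : Module.End ℚ V))
      map_add' := fun Y Y' => funext fun i => by
        simp only [Submodule.coe_add, add_mul, map_add, Pi.add_apply]
      map_smul' := fun c Y => funext fun i => by
        simp only [Submodule.coe_smul, smul_mul_assoc, map_smul, Pi.smul_apply, RingHom.id_apply] }
  have hΛ : ∀ (Y : ↥S) i, Λ Y i = LinearMap.trace ℚ V ((Y : Module.End ℚ V) * (b i : Module.End ℚ V)) := fun Y i => rfl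
  have hker : 0 < Module.finrank ℚ ↥(LinearMap.ker Λ) := by
    have h1 := LinearMap.finrank_range_add_finrank_ker Λ
    have h2 : Module.finrank ℚ ↥(LinearMap.range Λ) ≤ r :=
      (Submodule.finrank_le _).trans (by rw [Module.finrank_fintype_fun_eq_card, Fintype.card_fin])
    omega
  obtain ⟨Y, hY, hY0⟩ := Submodule.exists_mem_ne_zero_of_ne_bot
    (fun h0 => by rw [h0, finrank_bot] at hker; exact lt_irrefl 0 hker : LinearMap.ker Λ ≠ ⊥)
  refine ⟨Y, Y.2, fun h0 => hY0 (Subtype.ext h0), fun X hX => ?_⟩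
  have hX' : (⟨X, hX⟩ : ↥N) = ∑ i, b.repr ⟨X, hX⟩ i • b i := (b.sum_repr ⟨X, hX⟩).symm
  have hXsum : X = ∑ i, b.repr ⟨X, hX⟩ i • (b i : Module.End ℚ V) := by
    have := congrArg Subtype.val hX'
    simpa only [Submodule.coe_sum, Submodule.coe_smul] using this
  rw [hXsum, Finset.mul_sum, map_sum]
  refine Finset.sum_eq_zero fun i _ => ?_
  have hi := congrFun (LinearMap.mem_ker.1 hY) i
  rw [hΛ, Pi.zero_apply] at hi
  rw [mul_smul_comm, map_smul, hi, smul_zero]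

section Hodge

variable [Module.Finite ℚ V] [HodgeTensorFacts.{u, u}]

/-! ### §2 The LIFT property for one balanced place -/

/-- **THE LIFT PROPERTY FOR A CM FIELD WITH ONE BALANCED PLACE** (see the module docstring; `n₀ = 2`, `|ι| ≤ 3`, `k₀` the
unique balanced place, the others `Θ`-scalar; `𝔤` bracket-closed admissible with `Θ ∈ 𝔤_ℂ` and every `W_{μ k}`
`𝔤`-irreducible): for every `k` and every traceless `Z ∈ End(W_{μ k})` there is `X ∈ 𝔤_ℂ` inducing `Z` on `W_{μ k}` and `0`
on the other `W_{μ j}`. [cite: MoonenZarhin1999LowDim, §2 (2.3)] [cite: Ribet1983, §3 and Thm. 0]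
[cite: Deligne1982HodgeCycles, I §3 (proof of Prop. 3.4)] -/
theorem CMNoTwist.lift_of_unique_balanced {ι : Type} [Fintype ι] [DecidableEq ι] (hι : Fintype.card ι ≤ 3)
    (H : HodgeStructure V n) (hn : n = 1) (heff : H.IsEffective) (ψ : H.Polarization)
    {φ : Module.End ℚ V} (hφE : φ ∈ H.endAlg) {m : ℕ} (hE : ∀ a ∈ H.endAlg, ∃ q : Fin m → ℚ, a = ∑ k, q k • φ ^ (k : ℕ))
    (hdiv : ∀ a ∈ H.endAlg, a ≠ 0 → ∃ b : Module.End ℚ V, b * a = 1)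
    (μ : ι → ℂ) (hinj : Function.Injective μ) (hdist : ∀ k k', μ k' ≠ starRingEnd ℂ (μ k))
    (hrank : ∀ k, Module.finrank ℂ ↥(Module.End.eigenspace (φ.baseChange ℂ) (μ k) ⊓ H.piece 1 0) +
      Module.finrank ℂ ↥(Module.End.eigenspace (φ.baseChange ℂ) (μ k) ⊓ H.piece 0 1) = 2)
    (htop : (⨆ kt : ι × Fin 2, Module.End.eigenspace (φ.baseChange ℂ)
      (if kt.2 = 0 then μ kt.1 else starRingEnd ℂ (μ kt.1))) = ⊤)
    (𝔤 : Submodule ℚ (Module.End ℚ V)) (hbr : ∀ X ∈ 𝔤, ∀ X' ∈ 𝔤, X * X' - X' * X ∈ 𝔤)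
    (hcomm : ∀ X ∈ 𝔤, ∀ a : H.endAlg, X * (a : Module.End ℚ V) = (a : Module.End ℚ V) * X)
    (hskew : ∀ X ∈ 𝔤, ∀ v w, ψ.form (X v) w + ψ.form v (X w) = 0)
    {Θ : Module.End ℂ (ℂ ⊗[ℚ] V)} (hΘ : ∀ p, ∀ x ∈ H.piece p (n - p), Θ x = ((2 * p - n : ℤ) : ℂ) • x)
    (hΘ𝔤 : Θ ∈ spanC 𝔤)
    (hirr : ∀ k, ∀ U ≤ Module.End.eigenspace (φ.baseChange ℂ) (μ k),
      (∀ X ∈ 𝔤, ∀ u ∈ U, X.baseChange ℂ u ∈ U) → U = ⊥ ∨ U = Module.End.eigenspace (φ.baseChange ℂ) (μ k))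
    (k₀ : ι) (hk₀ : Module.finrank ℂ ↥(Module.End.eigenspace (φ.baseChange ℂ) (μ k₀) ⊓ H.piece 1 0) ≠ 0 ∧
      Module.finrank ℂ ↥(Module.End.eigenspace (φ.baseChange ℂ) (μ k₀) ⊓ H.piece 0 1) ≠ 0)
    (hunb : ∀ k, k ≠ k₀ → Module.finrank ℂ ↥(Module.End.eigenspace (φ.baseChange ℂ) (μ k) ⊓ H.piece 1 0) = 0 ∨
      Module.finrank ℂ ↥(Module.End.eigenspace (φ.baseChange ℂ) (μ k) ⊓ H.piece 0 1) = 0)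
    (k : ι) (Z : Module.End ℂ ↥(Module.End.eigenspace (φ.baseChange ℂ) (μ k))) (hZ : LinearMap.trace ℂ _ Z = 0) :
    ∃ X ∈ spanC 𝔤, (∀ w : ↥(Module.End.eigenspace (φ.baseChange ℂ) (μ k)), X w = Z w) ∧
      ∀ j, j ≠ k → ∀ w ∈ Module.End.eigenspace (φ.baseChange ℂ) (μ j), X w = 0 := by
  classical
  -- notation and basic facts
  haveI : Module.Free ℚ V := Module.Free.of_divisionRing ℚ V
  let W : ι → Submodule ℂ (ℂ ⊗[ℚ] V) := fun i => Module.End.eigenspace (φ.baseChange ℂ) (μ i)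
  have hWdef : ∀ i, W i = Module.End.eigenspace (φ.baseChange ℂ) (μ i) := fun i => rfl
  let 𝔡 : Submodule ℚ (Module.End ℚ V) := Submodule.span ℚ {B | ∃ X ∈ 𝔤, ∃ X' ∈ 𝔤, X * X' - X' * X = B}
  have h𝔡def : 𝔡 = Submodule.span ℚ {B | ∃ X ∈ 𝔤, ∃ X' ∈ 𝔤, X * X' - X' * X = B} := rfl
  have h𝔡𝔤 : 𝔡 ≤ 𝔤 := CMDerived.derived_le hbr
  have h𝔇𝔊 : spanC 𝔡 ≤ spanC 𝔤 := spanC_mono h𝔡𝔤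
  have hSφ : ∀ Y ∈ spanC 𝔤, Y * φ.baseChange ℂ = φ.baseChange ℂ * Y := fun Y hY =>
    UnitaryTheta.commute_of_mem_spanC H hφE hcomm hY
  have hSW : ∀ Y ∈ spanC 𝔤, ∀ i, ∀ w ∈ W i, Y w ∈ W i := fun Y hY i w hw =>
    UnitaryTheta.apply_mem_eigenspace_of_commute (hSφ Y hY) hw
  have hXφ : ∀ X ∈ 𝔤, X.baseChange ℂ * φ.baseChange ℂ = φ.baseChange ℂ * X.baseChange ℂ := fun X hX =>
    UnitaryTheta.baseChange_commute H hφE hcomm hX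
  have hXW : ∀ X ∈ 𝔤, ∀ i, ∀ w ∈ W i, X.baseChange ℂ w ∈ W i := fun X hX i w hw =>
    UnitaryTheta.apply_mem_eigenspace_of_commute (hXφ X hX) hw
  have hΘφ : Θ * φ.baseChange ℂ = φ.baseChange ℂ * Θ := hSφ Θ hΘ𝔤
  have hfin : ∀ i, Module.finrank ℂ ↥(W i) = 2 := fun i => by
    rw [hWdef, CMTheta.finrank_eigenspace_eq_add H hn heff hφE, hrank i]
  let bW : ∀ i, Module.Basis (Fin 2) ℂ ↥(W i) := fun i => Module.finBasisOfFinrankEq ℂ _ (hfin i)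
  -- the complex derived span `𝔇` and the inputs of Ribet's lemma
  have hbr𝔇 : ∀ X ∈ spanC 𝔡, ∀ Y ∈ spanC 𝔡, X * Y - Y * X ∈ spanC 𝔡 := fun X hX Y hY =>
    commutator_mem_spanC_derived (h𝔇𝔊 hX) (h𝔇𝔊 hY)
  have hW𝔇 : ∀ X ∈ spanC 𝔡, ∀ i, ∀ w ∈ W i, X w ∈ W i := fun X hX i => hSW X (h𝔇𝔊 hX) i
  have htr𝔇 : ∀ X (hX : X ∈ spanC 𝔡) i, LinearMap.trace ℂ _ (X.restrict (hW𝔇 X hX i)) = 0 := fun X hX i =>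
    CMDerived.trace_restrict_eq_zero (fun Y hY => hXW Y hY i) hX _
  have hproj : ∀ i, ∀ Z : Module.End ℂ ↥(W i), LinearMap.trace ℂ _ Z = 0 → ∃ X ∈ spanC 𝔡, ∀ w : ↥(W i), X w = Z w :=
    fun i Z hZ => CMDerived.exists_mem_spanC_derived_forall_eq 𝔤 hbr (W i) (hfin i) (fun X hX => hXW X hX i) (hirr i) Z hZ
  have P := fun i₀ => Literature.Algebra.Lie.LieGoursatTwist.lift_or_twist_of_submodules (k := ℂ) W (d := 2) le_rfl bW
    (spanC 𝔡) hbr𝔇 hW𝔇 htr𝔇 hproj i₀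
  -- the matrices `M i X = [X|_{W i}]`; zero matrix ⟺ zero restriction
  have hM0 : ∀ i X (hX : X ∈ spanC 𝔡), LinearMap.toMatrix (bW i) (bW i) (X.restrict (hW𝔇 X hX i)) = 0 ↔
      ∀ w ∈ W i, X w = 0 := by
    intro i X hX
    rw [LinearEquiv.map_eq_zero_iff]
    constructor
    · intro h w hw
      have h' := LinearMap.congr_fun h ⟨w, hw⟩
      rw [LinearMap.zero_apply] at h'
      have h'' := congrArg Subtype.val h'
      rwa [LinearMap.coe_restrict_apply] at h''
    · intro h
      exact LinearMap.ext fun w => Subtype.ext (by rw [LinearMap.coe_restrict_apply, h w w.2]; rfl)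
  -- a twist `(i₀, j)` transports vanishing of restrictions in both directions
  have htrans : ∀ i₀ j (e : Fin 2 ≃ Fin 2) (A : Matrix (Fin 2) (Fin 2) ℂ), IsUnit A →
      (∀ X (hX : X ∈ spanC 𝔡), LinearMap.toMatrix (bW i₀) (bW i₀) (X.restrict (hW𝔇 X hX i₀)) =
        A⁻¹ * (LinearMap.toMatrix (bW j) (bW j) (X.restrict (hW𝔇 X hX j))).submatrix e.symm e.symm * A) →
      ∀ X (hX : X ∈ spanC 𝔡), ((∀ w ∈ W j, X w = 0) → ∀ w ∈ W i₀, X w = 0) ∧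
        ((∀ w ∈ W i₀, X w = 0) → ∀ w ∈ W j, X w = 0) := by
    intro i₀ j e A hA htw X hX
    constructor
    · intro h
      rw [← hM0 i₀ X hX, htw X hX, (hM0 j X hX).2 h, Matrix.submatrix_zero, Pi.zero_def, Pi.zero_def, Matrix.mul_zero,
        Matrix.zero_mul]
    · intro h
      have h1 := htw X hX
      rw [(hM0 i₀ X hX).2 h] at h1
      exact (hM0 j X hX).1 (CMNoTwist.eq_zero_of_conj_submatrix_eq_zero e hA h1.symm)
  -- a MIXED twist (between an unbalanced `u` and a balanced `b'`) is impossible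
  have hmixed : ∀ u b', (Module.finrank ℂ ↥(W u ⊓ H.piece 1 0) = 0 ∨ Module.finrank ℂ ↥(W u ⊓ H.piece 0 1) = 0) →
      (Module.finrank ℂ ↥(W b' ⊓ H.piece 1 0) ≠ 0 ∧ Module.finrank ℂ ↥(W b' ⊓ H.piece 0 1) ≠ 0) →
      (∀ X (hX : X ∈ spanC 𝔡), (∀ w ∈ W u, X w = 0) → ∀ w ∈ W b', X w = 0) → False := by
    intro u b' hu hb' himp
    obtain ⟨ε, hε⟩ := CMNoTwist.theta_eq_smul_of_unbalanced H hn heff hφE hΘ hu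
    refine CMNoTwist.false_of_theta_commute_of_balanced H hn heff hΘ hΘφ 𝔤 hXφ (hirr b') hb'.1 hb'.2 fun X hX w hw => ?_
    have hC : Θ * X.baseChange ℂ - X.baseChange ℂ * Θ ∈ spanC 𝔡 :=
      commutator_mem_spanC_derived hΘ𝔤 (baseChange_mem_spanC hX)
    have hu0 : ∀ w ∈ W u, (Θ * X.baseChange ℂ - X.baseChange ℂ * Θ) w = 0 := fun w hw => by
      rw [LinearMap.sub_apply, Module.End.mul_apply, Module.End.mul_apply, hε _ (hXW X hX u w hw), hε w hw, map_smul,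
        sub_self]
    have h := himp _ hC hu0 w hw
    rw [LinearMap.sub_apply, Module.End.mul_apply, Module.End.mul_apply, sub_eq_zero] at h
    exact h
  -- LIFT at `k₀` (a twist from `k₀` would be mixed)
  have hLk₀ : ∀ Z : Module.End ℂ ↥(W k₀), LinearMap.trace ℂ _ Z = 0 →
      ∃ X ∈ spanC 𝔡, (∀ w : ↥(W k₀), X w = Z w) ∧ ∀ j, j ≠ k₀ → ∀ w ∈ W j, X w = 0 := by
    rcases P k₀ with h | ⟨j, hj, e, A, hA, htw⟩
    · exact h
    · exfalso
      rcases htw with htw | ⟨h22, -⟩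
      · exact hmixed j k₀ (hunb j hj) hk₀ fun X hX => (htrans k₀ j e A hA htw X hX).1
      · exact lt_irrefl 2 h22
  -- the place `k` itself
  by_cases hkk₀ : k = k₀
  · subst hkk₀
    obtain ⟨X, hX, h1, h2⟩ := hLk₀ Z hZ
    exact ⟨X, h𝔇𝔊 hX, h1, h2⟩
  rcases P k with h | ⟨j, hj, e, A, hA, htw⟩
  · obtain ⟨X, hX, h1, h2⟩ := h Z hZ
    exact ⟨X, h𝔇𝔊 hX, h1, h2⟩
  exfalso
  rcases htw with htw | ⟨h22, -⟩
  swap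
  · exact lt_irrefl 2 h22
  by_cases hjk₀ : j = k₀
  · subst hjk₀
    exact hmixed k j (hunb k hkk₀) hk₀ fun X hX => (htrans k j e A hA htw X hX).2
  /- SAME TYPE: `k` and `j` are the two `Θ`-scalar places, `k₀` the balanced one. -/
  -- every place is one of `k, j, k₀`
  have huniv : ∀ i, i = k ∨ i = j ∨ i = k₀ := by
    have h3 : ({k, j, k₀} : Finset ι) = Finset.univ := by
      apply Finset.eq_of_subset_of_card_le (Finset.subset_univ _)
      rw [Finset.card_univ, Finset.card_insert_of_notMem (by simp [Ne.symm hj, hkk₀]),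
        Finset.card_insert_of_notMem (by simp [hjk₀]), Finset.card_singleton]
      exact hι
    intro i
    have hi : i ∈ ({k, j, k₀} : Finset ι) := by rw [h3]; exact Finset.mem_univ _
    simpa using hi
  -- `dim_ℚ 𝔡 ≥ 6`: restriction to `W k` is onto `𝔰𝔩(W k)` and its kernel maps onto `𝔰𝔩(W k₀)`
  have hδ : 6 ≤ Module.finrank ℚ 𝔡 := by
    rw [← finrank_spanC_eq]
    exact CMNoTwist.six_le_finrank (spanC 𝔡) (W k) (W k₀) (hfin k) (hfin k₀) (fun X hX => hW𝔇 X hX k)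
      (fun X hX => hW𝔇 X hX k₀) (hproj k) fun T hT => by
        obtain ⟨X, hX, hXT, hX0⟩ := hLk₀ T hT
        exact ⟨X, hX, hXT, hX0 k hkk₀⟩
  -- the symmetric element `b ∈ {φ + φ†, φφ†}` separating the places `k` and `j`
  have hadj := CMNoTwist.adjoint_baseChange_apply H hn heff ψ hφE hE μ hinj hdist two_ne_zero hrank htop
  have hEcomm : ∀ a ∈ H.endAlg, ∀ a' ∈ H.endAlg, a * a' = a' * a := fun a ha a' ha' =>
    CMThetaCentre.mul_comm_of_hE H hE ha ha'
  have hφadjE : ψ.adjoint φ ∈ H.endAlg := ψ.adjoint_mem_endAlg hφE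
  obtain ⟨b, τ, hbE, hbsym, hbτ, hτ⟩ : ∃ (b : Module.End ℚ V) (τ : ι → ℂ), b ∈ H.endAlg ∧
      (∀ v w, ψ.form (b v) w = ψ.form v (b w)) ∧ (∀ i, ∀ w ∈ W i, b.baseChange ℂ w = τ i • w) ∧ τ k ≠ τ j := by
    by_cases hs : μ k + starRingEnd ℂ (μ k) = μ j + starRingEnd ℂ (μ j)
    · refine ⟨φ * ψ.adjoint φ, fun i => μ i * starRingEnd ℂ (μ i), H.endAlg.mul_mem hφE hφadjE, fun v w => ?_,
        fun i w hw => ?_, fun h => ?_⟩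
      · rw [Module.End.mul_apply, Module.End.mul_apply, ← ψ.form_apply_adjoint, ψ.isAdjointPair_adjoint_left φ]
      · rw [LinearMap.baseChange_mul, Module.End.mul_apply, hadj i w hw, map_smul, Module.End.mem_eigenspace_iff.1 hw,
          smul_smul, mul_comm]
      · -- same sum and product: `μ j ∈ {μ k, conj μ k}`
        have hq : (μ j - μ k) * (μ j - starRingEnd ℂ (μ k)) = 0 := by linear_combination (-(μ j)) * hs + h
        rcases mul_eq_zero.1 hq with h1 | h1
        · exact hj (hinj (sub_eq_zero.1 h1))
        · exact hdist k j (sub_eq_zero.1 h1)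
    · refine ⟨φ + ψ.adjoint φ, fun i => μ i + starRingEnd ℂ (μ i), add_mem hφE hφadjE, fun v w => ?_,
        fun i w hw => ?_, hs⟩
      · rw [LinearMap.add_apply, LinearMap.add_apply, map_add, LinearMap.add_apply, map_add, ← ψ.form_apply_adjoint,
          ψ.isAdjointPair_adjoint_left φ, add_comm]
      · rw [LinearMap.baseChange_add, LinearMap.add_apply, hadj i w hw, Module.End.mem_eigenspace_iff.1 hw, add_smul]
  have hb0 : b ≠ 0 := by
    intro h
    have h1 := hbτ k _ (bW k 0).2
    have h2 := hbτ j _ (bW j 0).2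
    rw [h, LinearMap.baseChange_zero, LinearMap.zero_apply] at h1 h2
    have e1 : τ k = 0 := by
      by_contra hne
      exact (Submodule.coe_eq_zero.not.2 ((bW k).ne_zero 0)) ((smul_eq_zero.1 h1.symm).resolve_left hne)
    have e2 : τ j = 0 := by
      by_contra hne
      exact (Submodule.coe_eq_zero.not.2 ((bW j).ne_zero 0)) ((smul_eq_zero.1 h2.symm).resolve_left hne)
    exact hτ (e1.trans e2.symm)
  -- `N′ = {X ∈ 𝔡 : bX ∈ 𝔡}` has dimension `≥ 3`
  obtain ⟨binv, hbinv⟩ := hdiv b hbE hb0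
  have hLinj : Function.Injective (LinearMap.mulLeft ℚ b) := by
    rw [← LinearMap.ker_eq_bot, eq_bot_iff]
    intro a ha
    rw [LinearMap.mem_ker, LinearMap.mulLeft_apply] at ha
    rw [Submodule.mem_bot, ← one_mul a, ← hbinv, mul_assoc, ha, mul_zero]
  set N' : Submodule ℚ (Module.End ℚ V) := 𝔡 ⊓ 𝔡.comap (LinearMap.mulLeft ℚ b) with hN'
  have hN'3 : 3 ≤ Module.finrank ℚ N' := by
    have hsup : Module.finrank ℚ ↥(𝔡 ⊔ 𝔡.map (LinearMap.mulLeft ℚ b)) ≤ 9 :=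
      (CMDerived.finrank_sup_map_mulLeft_le H hn heff ψ hφE hE μ hinj hdist two_ne_zero hrank htop 𝔤 hbr hcomm hskew hbE
        hbsym).trans (by
          have h3 : (2 : ℕ) ^ 2 - 1 = 3 := by norm_num
          rw [h3]; omega)
    have hmap : Module.finrank ℚ ↥(𝔡.map (LinearMap.mulLeft ℚ b)) = Module.finrank ℚ 𝔡 :=
      (Submodule.equivMapOfInjective _ hLinj 𝔡).finrank_eq.symm
    have hinf := Submodule.finrank_sup_add_finrank_inf_eq 𝔡 (𝔡.map (LinearMap.mulLeft ℚ b))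
    have hle : 𝔡 ⊓ 𝔡.map (LinearMap.mulLeft ℚ b) ≤ N'.map (LinearMap.mulLeft ℚ b) := by
      rintro Y ⟨hY, hY'⟩
      obtain ⟨X, hX, rfl⟩ := Submodule.mem_map.1 hY'
      exact Submodule.mem_map.2 ⟨X, ⟨hX, hY⟩, rfl⟩
    have h1 := (Submodule.finrank_mono hle).trans (Submodule.finrank_map_le _ N')
    omega
  -- every `X ∈ N′` has `X_ℂ` vanishing on `W k` and on `W j` (the twist)
  have hN'van : ∀ X ∈ N', (∀ w ∈ W k, X.baseChange ℂ w = 0) ∧ ∀ w ∈ W j, X.baseChange ℂ w = 0 := by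
    intro X hXN
    obtain ⟨hX𝔡, hbX𝔡⟩ := Submodule.mem_inf.1 hXN
    rw [Submodule.mem_comap, LinearMap.mulLeft_apply] at hbX𝔡
    have hXC : X.baseChange ℂ ∈ spanC 𝔡 := baseChange_mem_spanC hX𝔡
    have hbXC : (b * X).baseChange ℂ ∈ spanC 𝔡 := baseChange_mem_spanC hbX𝔡
    have hMb : ∀ i, LinearMap.toMatrix (bW i) (bW i) (((b * X).baseChange ℂ).restrict (hW𝔇 _ hbXC i)) =
        τ i • LinearMap.toMatrix (bW i) (bW i) ((X.baseChange ℂ).restrict (hW𝔇 _ hXC i)) := by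
      intro i
      rw [← LinearEquiv.map_smul]
      congr 1
      exact LinearMap.ext fun w => Subtype.ext (by
        rw [LinearMap.coe_restrict_apply, LinearMap.smul_apply, Submodule.coe_smul, LinearMap.coe_restrict_apply,
          LinearMap.baseChange_mul, Module.End.mul_apply, hbτ i _ (hW𝔇 _ hXC i _ w.2)])
    have hXk : ∀ w ∈ W k, X.baseChange ℂ w = 0 := by
      rw [← hM0 k _ hXC]
      have h1 := htw _ hXC
      have h2 := htw _ hbXC
      rw [hMb k, hMb j] at h2
      simp only [Matrix.submatrix_smul, Pi.smul_apply, Matrix.mul_smul, Matrix.smul_mul] at h2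
      rw [← h1] at h2
      have h3 : (τ k - τ j) • LinearMap.toMatrix (bW k) (bW k) ((X.baseChange ℂ).restrict (hW𝔇 _ hXC k)) = 0 := by
        rw [sub_smul, h2, sub_self]
      exact (smul_eq_zero.1 h3).resolve_left (sub_ne_zero.2 hτ)
    exact ⟨hXk, (htrans k j e A hA htw _ hXC).2 hXk⟩
  -- the block `𝔫` of elements of `𝔇` killing `W k` and `W j`; `dim 𝔫 ≤ 3`
  have hVex : ∀ i, ∃ Vi : Submodule ℂ (Module.End ℂ (ℂ ⊗[ℚ] V)), ∀ Y, Y ∈ Vi ↔ ∀ w ∈ W i, Y w = 0 := fun i =>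
    ⟨{ carrier := {Y | ∀ w ∈ W i, Y w = 0}
       add_mem' := fun {Y Y'} hY hY' w hw => by rw [LinearMap.add_apply, hY w hw, hY' w hw, add_zero]
       zero_mem' := fun w _ => LinearMap.zero_apply w
       smul_mem' := fun c Y hY w hw => by rw [LinearMap.smul_apply, hY w hw, smul_zero] }, fun Y => Iff.rfl⟩
  obtain ⟨Vk, hVk⟩ := hVex k
  obtain ⟨Vj, hVj⟩ := hVex j
  set 𝔫 : Submodule ℂ (Module.End ℂ (ℂ ⊗[ℚ] V)) := spanC 𝔡 ⊓ Vk ⊓ Vj with h𝔫def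
  have hmem𝔫 : ∀ Y, Y ∈ 𝔫 ↔ Y ∈ spanC 𝔡 ∧ (∀ w ∈ W k, Y w = 0) ∧ ∀ w ∈ W j, Y w = 0 := fun Y => by
    rw [h𝔫def, Submodule.mem_inf, Submodule.mem_inf, hVk, hVj, and_assoc]
  have h𝔫𝔇 : 𝔫 ≤ spanC 𝔡 := fun Y hY => ((hmem𝔫 Y).1 hY).1
  have h𝔫3 : Module.finrank ℂ ↥𝔫 ≤ 3 := by
    refine CMNoTwist.finrank_le_three_of_vanish 𝔫 (W k₀) (hfin k₀) (fun Y hY => hW𝔇 Y (h𝔫𝔇 hY) k₀)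
      (fun Y hY => htr𝔇 Y (h𝔫𝔇 hY) k₀) fun Y hY hY0 => ?_
    obtain ⟨hY𝔇, hYk, hYj⟩ := (hmem𝔫 Y).1 hY
    refine CMThetaSocket.eq_zero_of_forall_eigenspace H hn heff ψ hφE hE μ hinj hdist htop (hSφ Y (h𝔇𝔊 hY𝔇))
      (ThetaSubalgebra.formBaseChange_add_eq_zero_of_mem_spanC ψ hskew (h𝔇𝔊 hY𝔇)) fun i w hw => ?_
    rcases huniv i with rfl | rfl | rfl
    · exact hYk w hw
    · exact hYj w hw
    · exact hY0 w hw
  -- `(N′)_ℂ = 𝔫`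
  have hspanN' : spanC N' = 𝔫 := by
    have hle : spanC N' ≤ 𝔫 := by
      unfold spanC
      refine Submodule.span_le.2 ?_
      rintro _ ⟨X, hX, rfl⟩
      rw [SetLike.mem_coe, hmem𝔫]
      exact ⟨baseChange_mem_spanC (Submodule.mem_inf.1 hX).1, hN'van X hX⟩
    exact Submodule.eq_of_le_of_finrank_le hle (h𝔫3.trans (by rw [finrank_spanC_eq]; exact hN'3))
  -- a non-zero `Y ∈ 𝔡` trace-orthogonal to `N′`
  have hN'lt : Module.finrank ℚ ↥N' < Module.finrank ℚ 𝔡 := by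
    have h := h𝔫3; rw [← hspanN', finrank_spanC_eq] at h; omega
  obtain ⟨Y, hY𝔡, hY0, hYorth⟩ := CMNoTwist.exists_ne_zero_trace_orthogonal 𝔡 N' (Module.finBasis ℚ ↥N') hN'lt
  have hYC : Y.baseChange ℂ ∈ spanC 𝔡 := baseChange_mem_spanC hY𝔡
  have hYskewC := ThetaSubalgebra.formBaseChange_add_eq_zero_of_mem_spanC ψ hskew (h𝔇𝔊 hYC)
  -- `Y_ℂ` kills `W k₀`: its restriction is trace-orthogonal to `𝔰𝔩(W k₀)`
  obtain ⟨cb, κ, hcbW, -, -, -, hdual, hiso⟩ := CMTheta.exists_adaptedDualBasis H hn heff ψ hφE hE μ hinj hdist hrank htop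
  have hYk₀ : ∀ w ∈ W k₀, Y.baseChange ℂ w = 0 := by
    set Yk₀ := (Y.baseChange ℂ).restrict (hW𝔇 _ hYC k₀) with hYk₀def
    obtain ⟨c, hc⟩ := CMNoTwist.exists_smul_one_of_forall_trace_mul_eq_zero (hfin k₀) Yk₀ fun Z' hZ' => by
      obtain ⟨L, hL, hLZ, hL0⟩ := hLk₀ Z' hZ'
      have hL𝔫 : L ∈ spanC N' := by
        rw [hspanN', hmem𝔫]; exact ⟨hL, hL0 k hkk₀, hL0 j hjk₀⟩
      have htr := CMThetaCentre.trace_mul_eq_zero_of_mem_spanC hYorth hL𝔫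
      have hLskew := ThetaSubalgebra.formBaseChange_add_eq_zero_of_mem_spanC ψ hskew (h𝔇𝔊 hL)
      rw [CMNoTwist.trace_mul_eq_sum_blocks cb (ψ.form.baseChange ℂ) hdual hiso _ L hYskewC hLskew,
        Finset.sum_eq_single k₀ (fun i _ hi => ?_) (fun h => absurd (Finset.mem_univ k₀) h)] at htr
      · -- the block `k₀`: both coordinate sums are `tr(Y|_{W k₀} Z′)`
        have hLr : L.restrict (hW𝔇 L hL k₀) = Z' := LinearMap.ext fun w => Subtype.ext (by
          rw [LinearMap.coe_restrict_apply, hLZ w])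
        have hYL : ∀ w ∈ W k₀, (Y.baseChange ℂ * L) w ∈ W k₀ := fun w hw => hW𝔇 _ hYC k₀ _ (hW𝔇 L hL k₀ w hw)
        have hLY : ∀ w ∈ W k₀, (L * Y.baseChange ℂ) w ∈ W k₀ := fun w hw => hW𝔇 L hL k₀ _ (hW𝔇 _ hYC k₀ w hw)
        have he0 : Function.Injective (fun jj : Fin 2 => (((k₀, (0 : Fin 2)), jj) : (ι × Fin 2) × Fin 2)) :=
          fun jj jj' h => by simpa using h
        rw [← CMArith.trace_restrict_eq_sum_repr cb _ he0 _ (hcbW k₀) (hfin k₀) _ hYL,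
          ← CMArith.trace_restrict_eq_sum_repr cb _ he0 _ (hcbW k₀) (hfin k₀) _ hLY] at htr
        have h1 : (Y.baseChange ℂ * L).restrict hYL = Yk₀ * Z' := by
          rw [← hLr]; exact LinearMap.ext fun w => Subtype.ext (by simp only [LinearMap.coe_restrict_apply,
            Module.End.mul_apply, hYk₀def])
        have h2 : (L * Y.baseChange ℂ).restrict hLY = Z' * Yk₀ := by
          rw [← hLr]; exact LinearMap.ext fun w => Subtype.ext (by simp only [LinearMap.coe_restrict_apply,
            Module.End.mul_apply, hYk₀def])
        rw [h1, h2, LinearMap.trace_mul_comm ℂ Z', ← two_mul, mul_eq_zero] at htr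
        exact htr.resolve_left two_ne_zero
      · -- the other blocks: `L` vanishes there
        have hi0 : ∀ w ∈ W i, L w = 0 := hL0 i hi
        rw [Finset.sum_eq_zero fun jj _ => ?_, Finset.sum_eq_zero fun jj _ => ?_, add_zero]
        · rw [Module.End.mul_apply, hi0 _ (hW𝔇 _ hYC i _ (hcbW i jj)), map_zero, Finsupp.zero_apply]
        · rw [Module.End.mul_apply, hi0 _ (hcbW i jj), map_zero, map_zero, Finsupp.zero_apply]
    -- `Y|_{W k₀} = c • 1` is traceless, so `c = 0`
    have htr0 := htr𝔇 _ hYC k₀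
    rw [show (Y.baseChange ℂ).restrict (hW𝔇 _ hYC k₀) = c • 1 from hc, map_smul, LinearMap.trace_one, hfin k₀,
      smul_eq_mul, mul_eq_zero] at htr0
    have hc0 : c = 0 := htr0.resolve_right two_ne_zero
    intro w hw
    have h := LinearMap.congr_fun hc ⟨w, hw⟩
    rw [hc0, zero_smul, LinearMap.zero_apply] at h
    have h' := congrArg Subtype.val h
    rwa [LinearMap.coe_restrict_apply, Submodule.coe_zero] at h'
  -- hence `Y_ℂ` kills every balanced block (only `k₀` is balanced), so `Y = 0`: contradiction
  refine hY0 (CMDerived.eq_zero_of_forall_balanced H hn heff ψ hφE hE μ hinj hdist two_ne_zero hrank htop 𝔤 hbr hcomm hskew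
    hΘ hΘ𝔤 hirr hY𝔡 fun i h10 h01 => ?_)
  by_cases hik₀ : i = k₀
  · subst hik₀; exact hYk₀
  · exact ((hunb i hik₀).elim (fun h => (h10 h).elim) fun h => (h01 h).elim)

end Hodge

end HodgeStructure

end Literature.AlgebraicGeometry.Motives
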